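import Summits.QuantumFields.YangMills.Theorems.BalabanUVNodesN07PointFeasibilityOneLevelSymbol
import HarnessLib

/-!
# DAG node N07 [B11], road R0′ — the ONE-LEVEL MARGIN in x-space: the CENTRE form vs the MATCHED form `‖Δ⁻¹Q′ᴴβ‖²` on the torus
# `T_η = Tor (fine n M)`, their block-Fourier diagonalisations, and the transfer «symbol margin ⇒ form margin»

Cell `pub-ymgap` (HUMAN RULINGS D-0062 ∕ D-0149 ∕ D-0154), width seat `pub-ymgap-dag-n07-w5` g2 (harness re-seat), 2026-08-28.  `--kind proof
--supports <K1 key> --as helper` (count-neutral helper on the N07 [B11] row; CLAIM-1 cell bus 2026-08-28T10:08Z).  This is the x-space dress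
of item (★)₁ of the located note `pub-ymgap-dag-n07-w5/LOCATED-PD-LOCALIZATION-ROAD.md` (§0–§1): what road item (L4) (IMS assembly) consumes.

THE PRINT.  [B5] = T. Bałaban, *Propagators and renormalization transformations for lattice gauge theories. I*, Commun. Math. Phys. **95** (1984)
17–40 `[Balaban1984PropagatorsI]`: (1.20) p. 20 (`Q′_k`), Sect. C p. 22 («Q′_kΔ⁻²Q′*_k», typed `B5Substitution125.Mop`), (1.29)–(1.33) p. 23
(`p = p′ + l`, `u_k`, «Σ_l |u_k(p′+l)|²∕Δ²(p′+l)», typed `B5Momentum133.Xs`); [B6] = CMP **96** (1984) 223–250 `[Balaban1984PropagatorsII]`, (2.22)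
p. 226 (the block-MEAN letters); [I] = CMP **109** (1987) 249–301 `[Balaban1987RG1]`, (0.4) p. 253 (the averaging of record samples block CENTRES, odd `L`).

THE TWO FORMS (one averaging level, block side `n`, coarse torus `T₁ = Tor M`, `β : T₁ → ℂ` a block function, `b := Q′ᴴβ` its block-constant
extension, `w := Δ⁻²b` with [B5]'s `Δ⁻¹` vanishing on constants):
* the MATCHED form `K₀(β) := ⟨β, Q′Δ⁻²Q′ᴴβ⟩ = ⟨b, Δ⁻²b⟩ = ‖Δ⁻¹b‖²` ([B6] (2.22): block means against block means);
* the CENTRE form `K_j(β) := Σ_y conj β(y) · w(ny + j)` (the value of `w` at the site `j` of block `y`; the centre is `j = c₀`, `2c₀+1 = n`).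
By Parseval on both tori, `dft_Mop_apply` ([B5] (1.30)–(1.33)), g0′'s `dft_sample` and `dft_QsOp_adjoint`: `K₀(β) = c_Q² Σ_{p′} Xs(p′)|β̂(p′)|²` and
`K_j(β) = c_Q² Σ_{p′} K_j(p′)|β̂(p′)|²` with the SAME constant, where `Xs(p′) = Σ_l |u(p′+l)|²∕Δ(p′+l)²` and
`K_j(p′) = Σ_l e^{i(p′+l)·ηj} conj u(p′+l)∕Δ(p′+l)²` (g0′'s centre symbol, a positive real at `j = c₀`, `p′ ≠ 0`); both symbols vanish at `p′ = 0`.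
Hence (★★ `matchedForm_le_centreForm_of_symbol`) a per-frequency margin `c·Xs(p′) ≤ Re K_j(p′)` (`p′ ≠ 0`) transfers to the forms:
`c·‖Δ⁻¹Q′ᴴβ‖² ≤ Re K_j(β)` for EVERY `β` — the display (★)₁ «`c·‖Δw_β‖²  ≤ Σ_B β_B|B| w_β(c_B)`» of the located note, up to the common factor.
The symbol margin itself is NOT proved here: at `c = 0` it is g0′'s positivity (★ `centreSymbol_re_pos`, giving ★★ `centreForm_re_nonneg`); an explicit
`c > 0` is dag-n07-w7 g4's CLAIM-1 `…N07AliasSumMargin` (announced constant `(2L)^{−|J|}`), to be imported BY NAME in a sequel; numerically `c = 1`.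

HONEST FRAMING (binding).  Count-neutral helper; finite Fourier bookkeeping on one torus at ONE averaging level; asserts NOTHING of [B11]∕[B6]∕[3]'s
analysis; the multi-level `(P)_D` ∕ the IMS road (L2)–(L4) for the record's family `Node00.cubeDomains` stay OPEN; under road (a) of the K0 lineage
none of this is consumed (located-research insurance for the R0′-native junction `hker`).  `hker` ∕ stub 1 ∕ K0⁷ ∕ K1⁸ NOT closed; N07 NOT discharged;
counts unmoved; no summit statement is proved by this seat — R4 closes the conditional finite-𝕋⁴ rung `BalabanLadder.UV` only; nothing continuum ∕ ℝ⁴ ∕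
OS ∕ mass gap ∕ Clay.  No `sorry`, no `def`, no `instance`, no `notation`.
-/

noncomputable section

open scoped BigOperators Matrix ComplexConjugate
open Finset Complex

namespace Summit.QuantumFields.YangMills.BalabanUVNodes.N07PointFeasibilityOneLevel

open Literature.MathematicalPhysics.QuantumFieldTheory.Balaban1983to89
open B5Prop11Plancherel (Tor chi dft fine sOf dft_mem_unitaryGroup)
open B5Block118 (cT bpt pOf iota cQ uSym_sOf_zero QsOp)
open B5Prop11Fiber (uSym)
open B5LaplaceInverse (lsym LapSinv LapSinv_conjTranspose)
open B5Momentum130 (lsym_zero)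
open B5Momentum133 (Xs dft_LapSinv_apply dft_Mop_apply Xs_eq Xs_re_pos lsym_pOf_ne_zero)
open B5Substitution125 (Mop Mop_mulVec)
open B5Adjoint130 (dft_QsOp_adjoint)
open B5FiberZero (pOf_zero)

/-! ## §6  Parseval on a torus and the momentum picture of `w = Δ⁻²Q′ᴴβ` -/

section Parseval

variable {d : ℕ} (N : Fin d → ℕ) [hN : ∀ μ, NeZero (N μ)]

/-- Parseval for the unitary DFT of a torus, polarised: `⟨f, g⟩ = ⟨f̂, ĝ⟩`. [folklore] -/
theorem star_dotProduct_eq_dft (f g : Tor N → ℂ) :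
    star f ⬝ᵥ g = star (dft N *ᵥ f) ⬝ᵥ (dft N *ᵥ g) := by
  have hU : star (dft N) * dft N = 1 := Matrix.mem_unitaryGroup_iff'.mp (dft_mem_unitaryGroup N)
  rw [Matrix.star_mulVec, ← Matrix.dotProduct_mulVec, Matrix.mulVec_mulVec,
    ← Matrix.star_eq_conjTranspose, hU, Matrix.one_mulVec]

/-- `⟨g, g⟩ = Σ_x |g(x)|²` (as a complex number). [folklore] -/
theorem star_dotProduct_self (g : Tor N → ℂ) : star g ⬝ᵥ g = ((∑ x, ‖g x‖ ^ 2 : ℝ) : ℂ) := by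
  simp only [dotProduct, Pi.star_apply, Complex.star_def, Complex.ofReal_sum, Complex.ofReal_pow]
  exact Finset.sum_congr rfl fun i _ => Complex.conj_mul' (g i)

end Parseval

section Forms

variable {d : ℕ} (n : ℕ) [NeZero n] (M : Fin d → ℕ) [hM : ∀ μ, NeZero (M μ)] (c : ℂ)

/-- **Momentum picture of `w = Δ⁻²Q′ᴴβ`**: `ŵ(p′+l) = c_Q · conj u(p′+l)∕Δ(p′+l)² · β̂(p′)` (with `Δ⁻¹(0) := 0`).
[cite: Balaban1984PropagatorsI, (1.30)–(1.32) p.23] -/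
theorem dft_lapInvSq_QsOpH_apply (β : Tor M → ℂ) (k : Fin d → Fin n) (q : Tor M) :
    (dft (fine n M) *ᵥ (LapSinv (fine n M) c *ᵥ (LapSinv (fine n M) c *ᵥ ((QsOp n M)ᴴ *ᵥ β)))) (pOf n M (k, q))
      = (cQ n M : ℂ) * conj (uSym n k (sOf M q)) / lsym (fine n M) c (pOf n M (k, q)) ^ 2 * (dft M *ᵥ β) q := by
  rw [dft_LapSinv_apply, dft_LapSinv_apply, dft_QsOp_adjoint]
  ring

/-- **The matched form in momentum space**: `⟨β, Q′Δ⁻²Q′ᴴβ⟩ = c_Q² Σ_{p′} Xs(p′)·|β̂(p′)|²` with `Xs(p′) = Σ_l |u(p′+l)|²∕Δ(p′+l)²`.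
[cite: Balaban1984PropagatorsI, (1.33) p.23; Balaban1984PropagatorsII, (2.22) p.226] -/
theorem matchedForm_eq_sum (β : Tor M → ℂ) :
    star β ⬝ᵥ (Mop n M c *ᵥ β) = (cQ n M : ℂ) ^ 2 * ∑ q, Xs n M c q * ((‖(dft M *ᵥ β) q‖ ^ 2 : ℝ) : ℂ) := by
  rw [star_dotProduct_eq_dft M, dotProduct, Finset.mul_sum]
  refine Finset.sum_congr rfl fun q _ => ?_
  rw [Pi.star_apply, dft_Mop_apply, Complex.star_def, Complex.ofReal_pow, ← Complex.conj_mul']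
  ring

/-- **The matched form is `‖Δ⁻¹Q′ᴴβ‖²`** (`Δ⁻¹` is self-adjoint). [cite: Balaban1984PropagatorsI, Sect. C p.22] -/
theorem matchedForm_eq_norm_sq (β : Tor M → ℂ) :
    star β ⬝ᵥ (Mop n M c *ᵥ β)
      = ((∑ x, ‖(LapSinv (fine n M) c *ᵥ ((QsOp n M)ᴴ *ᵥ β)) x‖ ^ 2 : ℝ) : ℂ) := by
  rw [Mop_mulVec, ← star_dotProduct_self]
  set v : Tor (fine n M) → ℂ := (QsOp n M)ᴴ *ᵥ β with hv
  set L : Matrix (Tor (fine n M)) (Tor (fine n M)) ℂ := LapSinv (fine n M) c with hL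
  have hsv : star v = star β ᵥ* QsOp n M := by
    rw [hv, Matrix.star_mulVec, Matrix.conjTranspose_conjTranspose]
  have hsL : star (L *ᵥ v) = star v ᵥ* L := by
    rw [Matrix.star_mulVec, hL, LapSinv_conjTranspose]
  rw [hsL, hsv]
  simp only [Matrix.dotProduct_mulVec]

/-- The matched form is a non-negative real. [folklore] -/
theorem matchedForm_re_nonneg (β : Tor M → ℂ) : 0 ≤ (star β ⬝ᵥ (Mop n M c *ᵥ β)).re := by
  rw [matchedForm_eq_norm_sq, Complex.ofReal_re]
  exact Finset.sum_nonneg fun x _ => sq_nonneg _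

/-- **Coarse transform of the point samples** (g0′'s `dft_sample` with the constant named): `(y ↦ g(ny+j))^(p′) = c_Q Σ_l e^{i(p′+l)·ηj} ĝ(p′+l)`.
[cite: Balaban1987RG1, (0.4) p.253; folklore] -/
theorem dft_sample_apply (g : Tor (fine n M) → ℂ) (j : Fin d → Fin n) (q : Tor M) :
    (dft M *ᵥ (fun y => g (bpt n M y j))) q
      = (cQ n M : ℂ) * ∑ k : Fin d → Fin n, chi (fine n M) (pOf n M (k, q)) (iota n M j) *
          (dft (fine n M) *ᵥ g) (pOf n M (k, q)) := by
  have h := dft_sample n M g j q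
  simp only [Matrix.mulVec, dotProduct] at h ⊢
  rw [h, cQ]
  push_cast
  ring

/-- **The centre form in momentum space**: `Σ_y conj β(y)·w(ny+j) = c_Q² Σ_{p′} K_j(p′)·|β̂(p′)|²` with
`K_j(p′) = Σ_l e^{i(p′+l)·ηj} conj u(p′+l)∕Δ(p′+l)²` (g0′'s centre-sampling symbol). [cite: Balaban1984PropagatorsI, (1.30)–(1.33) p.23;
Balaban1987RG1, (0.4) p.253] -/
theorem centreForm_eq_sum (β : Tor M → ℂ) (j : Fin d → Fin n) :
    star β ⬝ᵥ (fun y => (LapSinv (fine n M) c *ᵥ (LapSinv (fine n M) c *ᵥ ((QsOp n M)ᴴ *ᵥ β))) (bpt n M y j))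
      = (cQ n M : ℂ) ^ 2 * ∑ q, (∑ k : Fin d → Fin n, chi (fine n M) (pOf n M (k, q)) (iota n M j) *
          conj (uSym n k (sOf M q)) / lsym (fine n M) c (pOf n M (k, q)) ^ 2) * ((‖(dft M *ᵥ β) q‖ ^ 2 : ℝ) : ℂ) := by
  rw [star_dotProduct_eq_dft M, dotProduct, Finset.mul_sum]
  refine Finset.sum_congr rfl fun q _ => ?_
  rw [Pi.star_apply, dft_sample_apply, Complex.star_def, Complex.ofReal_pow, ← Complex.conj_mul']
  simp_rw [dft_lapInvSq_QsOpH_apply]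
  rw [Finset.mul_sum, Finset.mul_sum, Finset.sum_mul, Finset.mul_sum]
  refine Finset.sum_congr rfl fun k _ => ?_
  ring

/-- At the zero coarse mode the matched symbol vanishes (`u(l) = 0` for `l ≠ 0`, `Δ⁻¹(0) = 0`). [cite: Balaban1984PropagatorsI, (1.31) p.23] -/
theorem Xs_zero : Xs n M c 0 = 0 := by
  rw [Xs]
  refine Finset.sum_eq_zero fun k _ => ?_
  by_cases hk : k = 0
  · subst hk
    rw [pOf_zero, lsym_zero]
    simp
  · rw [uSym_sOf_zero, if_neg hk]
    simp

/-- At the zero coarse mode the centre symbol vanishes. [cite: Balaban1984PropagatorsI, (1.31) p.23] -/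
theorem centreSymbol_zero (j : Fin d → Fin n) :
    ∑ k : Fin d → Fin n, chi (fine n M) (pOf n M (k, 0)) (iota n M j) * conj (uSym n k (sOf M (0 : Tor M))) /
        lsym (fine n M) c (pOf n M (k, 0)) ^ 2 = 0 := by
  refine Finset.sum_eq_zero fun k _ => ?_
  by_cases hk : k = 0
  · subst hk
    rw [pOf_zero, lsym_zero]
    simp
  · rw [uSym_sOf_zero, if_neg hk]
    simp

/-- ★★ **TRANSFER «symbol margin ⇒ form margin»**: if at every non-zero coarse momentum `c·Xs(p′) ≤ Re K_j(p′)`, then for EVERY block function `β`,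
`c · ⟨β, Q′Δ⁻²Q′ᴴβ⟩ ≤ Re Σ_y conj β(y) w(ny+j)` (`w = Δ⁻²Q′ᴴβ`) — the centre form dominates `c` times the matched form `‖Δ⁻¹Q′ᴴβ‖²`.
[cite: Balaban1984PropagatorsI, (1.30)–(1.33) p.23; folklore] -/
theorem matchedForm_le_centreForm_of_symbol (j : Fin d → Fin n) (cst : ℝ)
    (hK : ∀ q : Tor M, q ≠ 0 → cst * (Xs n M c q).re ≤
      (∑ k : Fin d → Fin n, chi (fine n M) (pOf n M (k, q)) (iota n M j) * conj (uSym n k (sOf M q)) /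
        lsym (fine n M) c (pOf n M (k, q)) ^ 2).re)
    (β : Tor M → ℂ) :
    cst * (star β ⬝ᵥ (Mop n M c *ᵥ β)).re ≤
      (star β ⬝ᵥ (fun y => (LapSinv (fine n M) c *ᵥ (LapSinv (fine n M) c *ᵥ ((QsOp n M)ᴴ *ᵥ β))) (bpt n M y j))).re := by
  rw [matchedForm_eq_sum, centreForm_eq_sum, ← Complex.ofReal_pow, Complex.re_ofReal_mul, Complex.re_ofReal_mul,
    Complex.re_sum, Complex.re_sum, ← mul_assoc, mul_comm cst, mul_assoc, Finset.mul_sum]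
  refine mul_le_mul_of_nonneg_left (Finset.sum_le_sum fun q _ => ?_) (sq_nonneg _)
  rw [Complex.re_mul_ofReal, Complex.re_mul_ofReal, ← mul_assoc]
  refine mul_le_mul_of_nonneg_right ?_ (sq_nonneg _)
  by_cases hq : q = 0
  · subst hq
    rw [Xs_zero, centreSymbol_zero]
    simp
  · exact hK q hq

/-- ★★ the same, displayed with `‖Δ⁻¹Q′ᴴβ‖²`: `c·Σ_x |(Δ⁻¹Q′ᴴβ)(x)|² ≤ Re Σ_y conj β(y)·(Δ⁻²Q′ᴴβ)(ny+j)`.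
[cite: Balaban1984PropagatorsI, Sect. C p.22; folklore] -/
theorem norm_sq_lapInv_le_centreForm_of_symbol (j : Fin d → Fin n) (cst : ℝ)
    (hK : ∀ q : Tor M, q ≠ 0 → cst * (Xs n M c q).re ≤
      (∑ k : Fin d → Fin n, chi (fine n M) (pOf n M (k, q)) (iota n M j) * conj (uSym n k (sOf M q)) /
        lsym (fine n M) c (pOf n M (k, q)) ^ 2).re)
    (β : Tor M → ℂ) :
    cst * ∑ x, ‖(LapSinv (fine n M) c *ᵥ ((QsOp n M)ᴴ *ᵥ β)) x‖ ^ 2 ≤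
      (star β ⬝ᵥ (fun y => (LapSinv (fine n M) c *ᵥ (LapSinv (fine n M) c *ᵥ ((QsOp n M)ᴴ *ᵥ β))) (bpt n M y j))).re := by
  have h := matchedForm_le_centreForm_of_symbol n M c j cst hK β
  rwa [matchedForm_eq_norm_sq, Complex.ofReal_re] at h

end Forms

/-! ## §7  At the centre `j = c₀` (odd `n = 2c₀+1`, [B5]'s lattice constant `c = n`): the centre symbol is a positive real, so the
centre form is non-negative — the `c = 0` instance of the transfer -/

section Centre

variable {d : ℕ} (n : ℕ) [NeZero n] (M : Fin d → ℕ) [hM : ∀ μ, NeZero (M μ)]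

/-- ★ **The centre-sampling symbol is a POSITIVE real off the zero mode** (the quantitative form of g0′'s `centreSymbol_ne_zero`: the same collapse to
the support of `p′` and dag-n07-w7's `aliasSymbolK_pos` via `signed_alias_sum_pos`). [cite: Balaban1984PropagatorsI, (1.31) p.23;
Balaban1987RG1, (0.4) p.253] -/
theorem centreSymbol_re_pos (c₀ : Fin d → Fin n) (hc₀ : ∀ ν, 2 * (c₀ ν : ℕ) + 1 = n) {q : Tor M} (hq : q ≠ 0) :
    0 < (∑ k : Fin d → Fin n, chi (fine n M) (pOf n M (k, q)) (iota n M c₀) * conj (uSym n k (sOf M q)) /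
        lsym (fine n M) (n : ℂ) (pOf n M (k, q)) ^ 2).re := by
  classical
  simp_rw [summand_eq_real n M c₀ hc₀ q]
  rw [← Complex.ofReal_sum, Complex.ofReal_re]
  have hshift : ∀ (k : Fin d → Fin n) ν, B4Strip.shiftr n k (sOf M q) ν = sOf M q ν + 2 * Real.pi * ((k ν : ℕ) : ℝ) :=
    fun k ν => rfl
  simp_rw [hshift]
  rw [sum_collapse (fun ν => q ν ≠ 0)
    (fun ν m => if q ν = 0 then (if m = 0 then (1 : ℝ) else 0) else
      Real.sin ((sOf M q ν + 2 * Real.pi * ((m : ℕ) : ℝ)) / 2) /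
        ((n : ℝ) * Real.sin ((sOf M q ν + 2 * Real.pi * ((m : ℕ) : ℝ)) / (2 * n))))
    (fun ν m => B4Strip.Sxir n (sOf M q ν + 2 * Real.pi * ((m : ℕ) : ℝ)))]
  rotate_left
  · intro ν hν
    rw [not_not] at hν
    simp [hν]
  · intro ν m hν hm
    rw [not_not] at hν
    simp [hν, hm]
  · intro ν hν
    rw [not_not] at hν
    rw [(sOf_apply_eq_zero_iff M q ν).mpr hν]
    simp [B4Strip.Sxir]
  have hne : Nonempty {ν // q ν ≠ 0} := by
    obtain ⟨ν, hν⟩ := Function.ne_iff.mp hq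
    exact ⟨⟨ν, hν⟩⟩
  have hodd : Odd n := ⟨c₀ (Classical.choice hne).1, by have := hc₀ (Classical.choice hne).1; omega⟩
  have hsum := signed_alias_sum_pos (J := {ν // q ν ≠ 0}) hodd (fun κ => sOf M q κ.1)
    (fun κ => B5Prop11Plancherel.abs_sOf_le M q κ.1) (fun κ h => κ.2 ((sOf_apply_eq_zero_iff M q κ.1).mp h))
  refine hsum.trans_le (le_of_eq ?_)
  refine Finset.sum_congr rfl fun a _ => ?_
  congr 1
  exact Finset.prod_congr rfl fun κ _ => by rw [if_neg κ.2]

/-- ★★ **The centre form is NON-NEGATIVE** (one level, odd `n`, every `d`, every torus): `0 ≤ Re Σ_y conj β(y)·(Δ⁻²Q′ᴴβ)(ny+c₀)` — the `c = 0`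
instance of the transfer; at one level this is dag-n07-w7's criterion «`sym K ≽ 0`» of `LOCATED-PD-TILE-CRITERION.md`.
[cite: Balaban1984PropagatorsI, (1.30)–(1.33) p.23; Balaban1987RG1, (0.4) p.253] -/
theorem centreForm_re_nonneg (c₀ : Fin d → Fin n) (hc₀ : ∀ ν, 2 * (c₀ ν : ℕ) + 1 = n) (β : Tor M → ℂ) :
    0 ≤ (star β ⬝ᵥ (fun y => (LapSinv (fine n M) (n : ℂ) *ᵥ (LapSinv (fine n M) (n : ℂ) *ᵥ ((QsOp n M)ᴴ *ᵥ β)))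
      (bpt n M y c₀))).re := by
  have h := matchedForm_le_centreForm_of_symbol n M (n : ℂ) c₀ 0
    (fun q hq => by rw [zero_mul]; exact (centreSymbol_re_pos n M c₀ hc₀ hq).le) β
  rwa [zero_mul] at h

end Centre

end Summit.QuantumFields.YangMills.BalabanUVNodes.N07PointFeasibilityOneLevel

end
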